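import Summits.RiemannHypothesis.RiemannHypothesis.Theorems.SignConeOscillatory.Negative.OriginDominatingComb
import Mathlib.Analysis.Complex.ExponentialBounds
import Mathlib.Analysis.SpecialFunctions.Log.Basic

/-!
# `SignConeOscillatory` (crux stmt-RiemannHypothesis-16302) — negative lemma §A′, the concrete witness

The radii / centre bookkeeping of the witness of
`Theorems/SignConeOscillatory/Negative/WithoutPDOriginDominating.lean`: a plateau comb
`f u = b₀ u - ∑ i, (bᵢ (u - cᵢ) + bᵢ (u + cᵢ))` (`OriginDominatingComb.lean`) with

* central bump `b₀`: `rIn = 0.28`, `rOut = 0.32`;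
* four pairs: centres `c = (0.5, 0.86, 1.48, 2.14)`, inner radii `(0.14, 0.12, 0.06, 0.02)`, outer radii
  `(0.18, 0.16, 0.08, 0.04)` — supports `(0.32, 0.68)`, `(0.70, 1.02)`, `(1.40, 1.56)`, `(2.10, 2.18)`, i.e. below
  the first node `log 2` and inside the node gaps `(log 2, log 3)`, `(log 4, log 5)`, `(log 8, log 9)`.

Every lemma takes only the numerical data it needs (`b₀.rIn = 0.28`, …, the defining equation `hf`), so the main
file may realise the bumps by any `ContDiffBump`s with these radii.  Conclusions: the separation hypotheses of the
comb lemmas, `f = 0` at every node `log n` (`n ≥ 2`) and beyond `2.18`, `f(0.86) = -1`, and the value of `f` on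
each cell of the partition used by `OriginDominatingCells.lean`.  No definitions.
-/

noncomputable section

-- `Summit.RiemannHypothesis.RiemannHypothesis.…` repeats a namespace component by design (D-0017 layout).
set_option linter.dupNamespace false

open scoped BigOperators
open Set

namespace Summit.RiemannHypothesis.RiemannHypothesis.Theorems.SignConeOscillatory.Negative

section Witness

variable {b₀ : ContDiffBump (0 : ℝ)} {b : Fin 4 → ContDiffBump (0 : ℝ)} {c : Fin 4 → ℝ} {f : ℝ → ℝ}

/-! ## Radii and centres -/

/-- `rOutᵢ ≤ cᵢ`. -/
theorem w_cle (hbout : ∀ i, (b i).rOut = (![0.18, 0.16, 0.08, 0.04] : Fin 4 → ℝ) i)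
    (hc : c = ![0.5, 0.86, 1.48, 2.14]) : ∀ i, (b i).rOut ≤ c i := by
  intro i; fin_cases i <;> simp [hbout, hc] <;> norm_num

/-- The central support ends before every pair support: `b₀.rOut + rOutᵢ ≤ cᵢ`. -/
theorem w_far (hb₀out : b₀.rOut = 0.32) (hbout : ∀ i, (b i).rOut = (![0.18, 0.16, 0.08, 0.04] : Fin 4 → ℝ) i)
    (hc : c = ![0.5, 0.86, 1.48, 2.14]) : ∀ i, b₀.rOut + (b i).rOut ≤ c i := by
  intro i; fin_cases i <;> simp [hb₀out, hbout, hc] <;> norm_num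

/-- `b₀.rIn + rOutᵢ ≤ cᵢ`. -/
theorem w_far' (hb₀in : b₀.rIn = 0.28) (hbout : ∀ i, (b i).rOut = (![0.18, 0.16, 0.08, 0.04] : Fin 4 → ℝ) i)
    (hc : c = ![0.5, 0.86, 1.48, 2.14]) : ∀ i, b₀.rIn + (b i).rOut ≤ c i := by
  intro i; fin_cases i <;> simp [hb₀in, hbout, hc] <;> norm_num

/-- `0.32 + rOutᵢ ≤ cᵢ`. -/
theorem w_far32 (hbout : ∀ i, (b i).rOut = (![0.18, 0.16, 0.08, 0.04] : Fin 4 → ℝ) i)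
    (hc : c = ![0.5, 0.86, 1.48, 2.14]) : ∀ i, 0.32 + (b i).rOut ≤ c i := by
  intro i; fin_cases i <;> simp [hbout, hc] <;> norm_num

/-- Pair supports are pairwise disjoint: `rOutᵢ + rOutⱼ ≤ |cᵢ - cⱼ|`. -/
theorem w_sep (hbout : ∀ i, (b i).rOut = (![0.18, 0.16, 0.08, 0.04] : Fin 4 → ℝ) i)
    (hc : c = ![0.5, 0.86, 1.48, 2.14]) : ∀ i j, i ≠ j → (b i).rOut + (b j).rOut ≤ |c i - c j| := by
  intro i j hij
  fin_cases i <;> fin_cases j <;> simp [hbout, hc] at hij ⊢ <;> norm_num [abs_of_nonneg, abs_of_nonpos]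

/-- `rOutᵢ + rInⱼ ≤ |cᵢ - cⱼ|` for `i ≠ j`. -/
theorem w_sepIn (hbin : ∀ i, (b i).rIn = (![0.14, 0.12, 0.06, 0.02] : Fin 4 → ℝ) i)
    (hbout : ∀ i, (b i).rOut = (![0.18, 0.16, 0.08, 0.04] : Fin 4 → ℝ) i)
    (hc : c = ![0.5, 0.86, 1.48, 2.14]) : ∀ j i, i ≠ j → (b i).rOut + (b j).rIn ≤ |c i - c j| := by
  intro j i hij
  fin_cases i <;> fin_cases j <;> simp [hbin, hbout, hc] at hij ⊢ <;> norm_num [abs_of_nonneg, abs_of_nonpos]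

/-- All supports lie in `[-2.18, 2.18]`. -/
theorem w_R (hbout : ∀ i, (b i).rOut = (![0.18, 0.16, 0.08, 0.04] : Fin 4 → ℝ) i)
    (hc : c = ![0.5, 0.86, 1.48, 2.14]) : ∀ i, |c i| + (b i).rOut ≤ 2.18 := by
  intro i; fin_cases i <;> simp [hbout, hc] <;> norm_num [abs_of_nonneg]

/-! ## Values of the comb -/

/-- `f 0 = 1`. -/
theorem w_zero (hb₀in : b₀.rIn = 0.28) (hbout : ∀ i, (b i).rOut = (![0.18, 0.16, 0.08, 0.04] : Fin 4 → ℝ) i)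
    (hc : c = ![0.5, 0.86, 1.48, 2.14]) (hf : f = fun u => b₀ u - ∑ i, (b i (u - c i) + b i (u + c i))) :
    f 0 = 1 :=
  comb_zero hf (w_far' hb₀in hbout hc)

/-- `f u = 0` for `|u| ≥ 2.18`. -/
theorem w_zeroR (hb₀out : b₀.rOut = 0.32) (hbout : ∀ i, (b i).rOut = (![0.18, 0.16, 0.08, 0.04] : Fin 4 → ℝ) i)
    (hc : c = ![0.5, 0.86, 1.48, 2.14]) (hf : f = fun u => b₀ u - ∑ i, (b i (u - c i) + b i (u + c i)))
    {u : ℝ} (hu : 2.18 ≤ |u|) : f u = 0 :=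
  comb_eq_zero_of_le_abs hf (by rw [hb₀out]; norm_num) (w_R hbout hc) hu

/-- **Node vanishing**: `f (log n) = 0` for every `n ≥ 2` (`log 2 ∈ [0.68, 0.70]`, `log 3, log 4 ∈ [1.02, 1.40]`,
`log 5, …, log 8 ∈ [1.56, 2.10]`, `log n ≥ log 9 > 2.18` beyond). -/
theorem w_node (hb₀out : b₀.rOut = 0.32) (hbout : ∀ i, (b i).rOut = (![0.18, 0.16, 0.08, 0.04] : Fin 4 → ℝ) i)
    (hc : c = ![0.5, 0.86, 1.48, 2.14]) (hf : f = fun u => b₀ u - ∑ i, (b i (u - c i) + b i (u + c i)))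
    (hlog5 : (1.6 : ℝ) < Real.log 5) {n : ℕ} (hn : 2 ≤ n) : f (Real.log n) = 0 := by
  have hl4 : Real.log 4 = 2 * Real.log 2 := by
    rw [show (4 : ℝ) = 2 ^ 2 by norm_num, Real.log_pow]; norm_num
  have hl8 : Real.log 8 = 3 * Real.log 2 := by
    rw [show (8 : ℝ) = 2 ^ 3 by norm_num, Real.log_pow]; norm_num
  have hl9 : Real.log 9 = 2 * Real.log 3 := by
    rw [show (9 : ℝ) = 3 ^ 2 by norm_num, Real.log_pow]; norm_num
  have hl2 := Real.log_two_gt_d9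
  have hl2' := Real.log_two_lt_d9
  have hl3 := Real.log_three_gt_d9
  have hn2 : (2 : ℝ) ≤ n := by exact_mod_cast hn
  have hlog2n : Real.log 2 ≤ Real.log n := Real.log_le_log (by norm_num) hn2
  refine comb_eq_zero_of_nonneg hf (by linarith) (by rw [hb₀out]; linarith) (w_cle hbout hc) fun i => ?_
  fin_cases i <;> simp [hbout, hc]
  · exact le_abs.2 (Or.inl (by linarith))
  · rcases Nat.lt_or_ge n 3 with h3 | h3
    · have : n = 2 := by omega
      subst this
      exact le_abs.2 (Or.inr (by push_cast; linarith))
    · have h3' : Real.log 3 ≤ Real.log n := Real.log_le_log (by norm_num) (by exact_mod_cast h3)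
      exact le_abs.2 (Or.inl (by linarith))
  · rcases Nat.lt_or_ge n 5 with h5 | h5
    · have h4' : Real.log n ≤ Real.log 4 :=
        Real.log_le_log (by positivity) (by exact_mod_cast (by omega : n ≤ 4))
      exact le_abs.2 (Or.inr (by linarith))
    · have h5' : Real.log 5 ≤ Real.log n := Real.log_le_log (by norm_num) (by exact_mod_cast h5)
      exact le_abs.2 (Or.inl (by linarith))
  · rcases Nat.lt_or_ge n 9 with h9 | h9
    · have h8' : Real.log n ≤ Real.log 8 :=
        Real.log_le_log (by positivity) (by exact_mod_cast (by omega : n ≤ 8))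
      exact le_abs.2 (Or.inr (by linarith))
    · have h9' : Real.log 9 ≤ Real.log n := Real.log_le_log (by norm_num) (by exact_mod_cast h9)
      exact le_abs.2 (Or.inl (by linarith))

/-- On the pair plateaus `f = -1`: `[0.36, 0.64]`, `[0.74, 0.98]`, `[1.42, 1.54]`, `[2.12, 2.16]`. -/
theorem w_plateau (hb₀out : b₀.rOut = 0.32) (hbin : ∀ i, (b i).rIn = (![0.14, 0.12, 0.06, 0.02] : Fin 4 → ℝ) i)
    (hbout : ∀ i, (b i).rOut = (![0.18, 0.16, 0.08, 0.04] : Fin 4 → ℝ) i)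
    (hc : c = ![0.5, 0.86, 1.48, 2.14]) (hf : f = fun u => b₀ u - ∑ i, (b i (u - c i) + b i (u + c i)))
    (t : ℝ) :
    (t ∈ Icc (0.36 : ℝ) 0.64 → f t = -1) ∧ (t ∈ Icc (0.74 : ℝ) 0.98 → f t = -1) ∧
      (t ∈ Icc (1.42 : ℝ) 1.54 → f t = -1) ∧ (t ∈ Icc (2.12 : ℝ) 2.16 → f t = -1) := by
  have hcle := w_cle hbout hc
  have hsepIn := w_sepIn hbin hbout hc
  refine ⟨fun ht => ?_, fun ht => ?_, fun ht => ?_, fun ht => ?_⟩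
  · refine comb_eq_neg_one hf (by linarith [ht.1]) (by rw [hb₀out]; linarith [ht.1]) hcle 0 ?_ (hsepIn 0)
    simp only [hbin, hc]; simp
    exact abs_le.2 ⟨by linarith [ht.1], by linarith [ht.2]⟩
  · refine comb_eq_neg_one hf (by linarith [ht.1]) (by rw [hb₀out]; linarith [ht.1]) hcle 1 ?_ (hsepIn 1)
    simp only [hbin, hc]; simp
    exact abs_le.2 ⟨by linarith [ht.1], by linarith [ht.2]⟩
  · refine comb_eq_neg_one hf (by linarith [ht.1]) (by rw [hb₀out]; linarith [ht.1]) hcle 2 ?_ (hsepIn 2)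
    simp only [hbin, hc]; simp
    exact abs_le.2 ⟨by linarith [ht.1], by linarith [ht.2]⟩
  · refine comb_eq_neg_one hf (by linarith [ht.1]) (by rw [hb₀out]; linarith [ht.1]) hcle 3 ?_ (hsepIn 3)
    simp only [hbin, hc]; simp
    exact abs_le.2 ⟨by linarith [ht.1], by linarith [ht.2]⟩

/-- `f 0.86 = -1` (the oscillation witness: `0.86 ≥ log 2`). -/
theorem w_f86 (hb₀out : b₀.rOut = 0.32) (hbin : ∀ i, (b i).rIn = (![0.14, 0.12, 0.06, 0.02] : Fin 4 → ℝ) i)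
    (hbout : ∀ i, (b i).rOut = (![0.18, 0.16, 0.08, 0.04] : Fin 4 → ℝ) i)
    (hc : c = ![0.5, 0.86, 1.48, 2.14]) (hf : f = fun u => b₀ u - ∑ i, (b i (u - c i) + b i (u + c i))) :
    f 0.86 = -1 :=
  (w_plateau hb₀out hbin hbout hc hf 0.86).2.1 ⟨by norm_num, by norm_num⟩

/-- On the central plateau `f = 1`: `t ∈ (0, 0.28)`. -/
theorem w_pos1 (hb₀in : b₀.rIn = 0.28) (hbout : ∀ i, (b i).rOut = (![0.18, 0.16, 0.08, 0.04] : Fin 4 → ℝ) i)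
    (hc : c = ![0.5, 0.86, 1.48, 2.14]) (hf : f = fun u => b₀ u - ∑ i, (b i (u - c i) + b i (u + c i)))
    (t : ℝ) (ht : t ∈ Ioo (0 : ℝ) 0.28) : f t = 1 :=
  comb_eq_one hf (by rw [hb₀in, abs_of_pos ht.1]; exact ht.2.le) (w_far' hb₀in hbout hc)

/-- On the central shoulder `0 ≤ f ≤ 1`: `t ∈ (0.28, 0.32)`. -/
theorem w_possh (hbout : ∀ i, (b i).rOut = (![0.18, 0.16, 0.08, 0.04] : Fin 4 → ℝ) i)
    (hc : c = ![0.5, 0.86, 1.48, 2.14]) (hf : f = fun u => b₀ u - ∑ i, (b i (u - c i) + b i (u + c i)))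
    (t : ℝ) (ht : t ∈ Ioo (0.28 : ℝ) 0.32) : 0 ≤ f t ∧ f t ≤ 1 :=
  comb_mem_Icc_of_abs_le hf (r := 0.32) (by rw [abs_of_pos (by linarith [ht.1])]; exact ht.2.le) (w_far32 hbout hc)

/-- Beyond the central support `f ≤ 0`: `t ≥ 0.32`. -/
theorem w_nonpos (hb₀out : b₀.rOut = 0.32) (hbout : ∀ i, (b i).rOut = (![0.18, 0.16, 0.08, 0.04] : Fin 4 → ℝ) i)
    (hc : c = ![0.5, 0.86, 1.48, 2.14]) (hf : f = fun u => b₀ u - ∑ i, (b i (u - c i) + b i (u + c i)))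
    (t : ℝ) (ht : 0.32 ≤ t) : f t ≤ 0 :=
  (comb_mem_Icc_of_le hf (by linarith) (by rw [hb₀out]; exact ht) (w_cle hbout hc) (w_sep hbout hc)).2

end Witness

/-- Anchor of this file on the crux item (registered sub-goal): node vanishing of the witness (`w_node`,
`∀`-form). -/
theorem originDominating_witness_node : ∀ {b₀ : ContDiffBump (0 : ℝ)} {b : Fin 4 → ContDiffBump (0 : ℝ)} {c : Fin 4 → ℝ} {f : ℝ → ℝ}, b₀.rOut = 0.32 → (∀ i, (b i).rOut = (![0.18, 0.16, 0.08, 0.04] : Fin 4 → ℝ) i) → c = ![0.5, 0.86, 1.48, 2.14] → (f = fun u => b₀ u - ∑ i, (b i (u - c i) + b i (u + c i))) → (1.6 : ℝ) < Real.log 5 → ∀ n : ℕ, 2 ≤ n → f (Real.log n) = 0 :=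
  fun hb₀out hbout hc hf hlog5 _ hn => w_node hb₀out hbout hc hf hlog5 hn

end Summit.RiemannHypothesis.RiemannHypothesis.Theorems.SignConeOscillatory.Negative

end
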